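import Literature.AlgebraicGeometry.HodgeTheory.FermatInductiveClaimsDischargedLeaves
import Literature.AlgebraicGeometry.HodgeTheory.AokiShiodaSurfaceEigenlinesHolds
import Literature.AlgebraicGeometry.HodgeTheory.FermatClaimConjugation
import HarnessLib

/-!
# Cones over Hodge eigenlines of the Fermat surface: claim(`(c,-c) ∗ β`) on `X⁴ₘ` from the cone-span leaf (III-l), and the four type-`1` sextuples of `X⁴₆`

Family `hodge`, layer `Literature/AlgebraicGeometry/HodgeTheory`. PROOF FILE (theorems only; no
definition, no named fact; D-0026). N. Aoki, *Some new algebraic cycles on Fermat varieties*, J. Math.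
Soc. Japan 39 (1987), Thm. 1-4 (i) with `r = 0` (p. 388: "non-negative even integers"; p. 386
"represents ⟹ claim"): for a Hodge character `α = (c, -c)` of `X⁰ₘ` and a Hodge character `β ∈ 𝔅²ₘ` of
the Fermat SURFACE, claim(`α ∗ β`) holds on the Fermat FOURFOLD `X⁴ₘ` — in print by the cones over a
curve representing `β` with vertex a point of `X⁰ₘ` (Shioda, Math. Ann. 245 (1979), Thm. I; da Silva,
arXiv:2101.04739, Thm. 2.2 (b)).

On the tree's carriers the two inputs of that sentence have different status: claim(`β`) for EVERY
`β ∈ 𝔅²ₘ` is the THEOREM `AokiShioda1983_eigenline_le_neronSeveri_holds` (Aoki–Shioda 1983 (2.1):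
Lefschetz `(1,1)` on `X²ₘ`, file `AokiShiodaSurfaceEigenlinesHolds`), `dim V(α∗β) ≤ 1` is the theorem
`Ran1980_fermatEigenspace_le_span_holds`, and the transport of algebraic classes through a span plus
"represents ⟹ claim" is `FermatCharacter.Claim.append_of_coneSpan_represents_left`
(`FermatJuxtapositionGysin`); the GEOMETRIC input — a cone span `X²ₘ ←π— E —φ→ X⁴ₘ` whose push–pull
of some `w ∈ V(β)` has non-zero `(α∗β)`-component — is the named leaf
`Shioda1979_coneSpan_represents_left` (`FermatJuxtapositionSpans`, (III-l)), NOT proved in the tree.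
This file composes them:

* `FermatCharacter.claim_cone_surface_of_coneSpan` — (III-l) ⟹ claim(`α ∗ β`) on `X⁴ₘ` for all Hodge
  `α` of `X⁰ₘ`, `β` of `X²ₘ` (any `m ≥ 1`);
* `FermatCharacter.claim_cone_surface_of_juxtaposition` — the same from the parent named fact
  `Aoki1987_claim_juxtaposition` (claim on `X⁰ₘ` is trivial, `FermatCharacter.claim_zero`), for any
  sextuple `γ ∼ α ∗ β`;
* `fermatSextic_claims_typeOne_of_coneSpan`, `fermatSextic_claims_typeOne_of_juxtaposition` — the four
  sextuples `(1,2,2,3,5,5) ∼ (1,5) ∗ (2,2,3,5)`, `(3,4,4,5,1,1) ∼ (5,1) ∗ (3,4,4,1)` (with `(2,2,3,5)`,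
  `(3,4,4,1) ∈ 𝔅²₆`, `decide`) and their negatives `(5,4,4,3,1,1)`, `(3,2,2,1,5,5)`
  (`FermatCharacter.Claim.neg`) — the totally non-zero translates of Katz's flat type
  `(1,2,2,3,5,5)` of the Dwork sextic pencil and of its conjugate (consumer:
  `DworkSextic.isOfHodgeType_two_two_typeOne_of_claims`, route `DworkReflectionQuotients` of
  `Summits/HodgeConjecture`), CONDITIONAL on (III-l), resp. on `Aoki1987_claim_juxtaposition`.

Nothing unconditional about these four eigenlines is claimed: the file records that, for them, the
only missing input of the tree is the cone-span leaf (III-l) (alternatively: the ruled join of two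
curves, `Shioda1979_claim_semiDecomposable`, see `DworkSexticTopCharacter` §3).

## References

* [Aoki1987] N. Aoki, Some new algebraic cycles on Fermat varieties, J. Math. Soc. Japan 39 (1987)
  385–396: Thm. 1-4 (i) p. 388, p. 386.
* [Shioda1979HodgeFermat] T. Shioda, The Hodge conjecture for Fermat varieties, Math. Ann. 245 (1979)
  175–184, Thm. I.
* [AokiShioda1983] N. Aoki, T. Shioda, Generators of the Néron–Severi group of a Fermat surface,
  Progr. Math. 35 (1983), §2 (2.1).
* [daSilva2021HodgeFermat] G. da Silva Jr., Notes on the Hodge Conjecture for Fermat Varieties,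
  arXiv:2101.04739, Thm. 2.2 (b), Cor. 2.3 (a).
* [Ran1980] Z. Ran, Cycles on Fermat hypersurfaces, Compositio Math. 42 (1980), Prop. 1.7 (i).
* [Katz2009] N. M. Katz, Another look at the Dwork family, Progr. Math. 270 (2009), §3, Lemma 3.1.
-/

noncomputable section

open CategoryTheory Finset

namespace Literature.AlgebraicGeometry.HodgeTheory

open Literature.AlgebraicGeometry.Motives

namespace FermatCharacter

variable {m : ℕ}

/-- **Cones over Hodge eigenlines of the Fermat surface, granted the cone-span leaf (III-l)** (Aoki
Thm. 1-4 (i), `r = 0`, `s = 1`): for `m ≥ 1`, a Hodge character `α` of `X⁰ₘ` (a pair `(c, -c)`,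
`c ≠ 0`) and a Hodge character `β ∈ 𝔅²ₘ` of the Fermat surface, claim(`α ∗ β`) holds on `X⁴ₘ`.
Inputs: the named leaf `Shioda1979_coneSpan_represents_left` (hypothesis), and the theorems
`AokiShioda1983_eigenline_le_neronSeveri_holds` (claim(`β`)), `Ran1980_fermatEigenspace_le_span_holds`
(`dim V ≤ 1`), `FermatCharacter.Claim.append_of_coneSpan_represents_left` (flat pull-back, proper
push-forward, represents ⟹ claim). CONDITIONAL on (III-l) only.
[cite: Aoki1987, Thm. 1-4 (i) p. 388 and p. 386] [cite: AokiShioda1983, §2 (2.1)]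
[cite: daSilva2021HodgeFermat, Thm. 2.2 (b)] [cite: Ran1980, Prop. 1.7 (i)] -/
theorem claim_cone_surface_of_coneSpan (hC : Shioda1979_coneSpan_represents_left) [NeZero m]
    {α : Fin (2 * 0 + 2) → ZMod m} (hα : IsHodge α) {β : Fin (2 * 1 + 2) → ZMod m} (hβ : IsHodge β) :
    Claim m (0 + 1 + 1) (append α β) := by
  obtain ⟨μ, e, E, hE, hX, π, hπ, φ, he, hnv⟩ := hC m 1 α β le_rfl hα hβ
  haveI := hπ
  have hdim : ∃ u, fermatEigenspace m (append α β) (2 * (0 + 1 + 1)) ≤ ℂ ∙ u :=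
    Ran1980_fermatEigenspace_le_span_holds m (0 + 1 + 1) _ (Nat.succ_pos _) (hα.append hβ).1
  exact Claim.append_of_coneSpan_represents_left μ le_rfl hdim hE hX π φ he hnv
    (AokiShioda1983_eigenline_le_neronSeveri_holds m β hβ)

/-- **The same from Aoki's Thm. 1-4 (i) itself** (the parent named fact `Aoki1987_claim_juxtaposition`,
juxtaposition up to permutation): claim(`γ`) for every sextuple `γ ∼ α ∗ β` with `α` a Hodge
character of `X⁰ₘ` (claim trivial in dimension `0`, `claim_zero`) and `β ∈ 𝔅²ₘ` (claimed by
`AokiShioda1983_eigenline_le_neronSeveri_holds`). CONDITIONAL on `Aoki1987_claim_juxtaposition`.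
[cite: Aoki1987, Thm. 1-4 (i) p. 388] [cite: AokiShioda1983, §2 (2.1)] -/
theorem claim_cone_surface_of_juxtaposition (hJ : Aoki1987_claim_juxtaposition) [NeZero m]
    {α : Fin (2 * 0 + 2) → ZMod m} (hα : IsHodge α) {β : Fin (2 * 1 + 2) → ZMod m} (hβ : IsHodge β)
    {γ : Fin (2 * (0 + 1 + 1) + 2) → ZMod m} (hγ : univ.val.map γ = univ.val.map α + univ.val.map β) :
    Claim m (0 + 1 + 1) γ :=
  hJ m 0 1 α β γ hα hβ hγ (claim_zero m α) (AokiShioda1983_eigenline_le_neronSeveri_holds m β hβ)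

end FermatCharacter

/-! ### The four type-`1` sextuples of the Fermat sextic fourfold -/

/-- **(III-l) ⟹ the four type-`1` claims on the Fermat sextic fourfold `X⁴₆`**:
`(1,2,2,3,5,5) ∼ (1,5) ∗ (2,2,3,5)` and `(3,4,4,5,1,1) ∼ (5,1) ∗ (3,4,4,1)` with `(1,5)`, `(5,1)`
Hodge on `X⁰₆` and `(2,2,3,5)`, `(3,4,4,1) ∈ 𝔅²₆` (all `decide`); the remaining two are the negatives
(`FermatCharacter.Claim.neg`). CONDITIONAL on `Shioda1979_coneSpan_represents_left`.
[cite: Aoki1987, Thm. 1-4 (i) p. 388] [cite: AokiShioda1983, §2 (2.1)] [cite: Katz2009, Lemma 3.1] -/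
theorem fermatSextic_claims_typeOne_of_coneSpan (hC : Shioda1979_coneSpan_represents_left) :
    FermatCharacter.Claim 6 2 ![1, 2, 2, 3, 5, 5] ∧ FermatCharacter.Claim 6 2 ![3, 4, 4, 5, 1, 1] ∧
    FermatCharacter.Claim 6 2 ![5, 4, 4, 3, 1, 1] ∧ FermatCharacter.Claim 6 2 ![3, 2, 2, 1, 5, 5] := by
  have h₁ : FermatCharacter.Claim 6 2 ![1, 2, 2, 3, 5, 5] :=
    FermatCharacter.Claim.of_univ_val_map_eq (by decide)
      (FermatCharacter.claim_cone_surface_of_coneSpan hC (α := ![1, 5]) (β := ![2, 2, 3, 5])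
        (by unfold FermatCharacter.IsHodge FermatCharacter.IsAdmissible FermatCharacter.normSum; decide)
        (by unfold FermatCharacter.IsHodge FermatCharacter.IsAdmissible FermatCharacter.normSum; decide))
  have h₂ : FermatCharacter.Claim 6 2 ![3, 4, 4, 5, 1, 1] :=
    FermatCharacter.Claim.of_univ_val_map_eq (by decide)
      (FermatCharacter.claim_cone_surface_of_coneSpan hC (α := ![5, 1]) (β := ![3, 4, 4, 1])
        (by unfold FermatCharacter.IsHodge FermatCharacter.IsAdmissible FermatCharacter.normSum; decide)
        (by unfold FermatCharacter.IsHodge FermatCharacter.IsAdmissible FermatCharacter.normSum; decide))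
  refine ⟨h₁, h₂, ?_, ?_⟩
  · have e : (![5, 4, 4, 3, 1, 1] : Fin (2 * 2 + 2) → ZMod 6) = -![1, 2, 2, 3, 5, 5] := by decide
    rw [e]; exact h₁.neg
  · have e : (![3, 2, 2, 1, 5, 5] : Fin (2 * 2 + 2) → ZMod 6) = -![3, 4, 4, 5, 1, 1] := by decide
    rw [e]; exact h₂.neg

/-- **`Aoki1987_claim_juxtaposition` ⟹ the four type-`1` claims on `X⁴₆`** (same decompositions,
through `FermatCharacter.claim_cone_surface_of_juxtaposition`). CONDITIONAL on
`Aoki1987_claim_juxtaposition`. [cite: Aoki1987, Thm. 1-4 (i) p. 388] [cite: AokiShioda1983, §2 (2.1)] -/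
theorem fermatSextic_claims_typeOne_of_juxtaposition (hJ : Aoki1987_claim_juxtaposition) :
    FermatCharacter.Claim 6 2 ![1, 2, 2, 3, 5, 5] ∧ FermatCharacter.Claim 6 2 ![3, 4, 4, 5, 1, 1] ∧
    FermatCharacter.Claim 6 2 ![5, 4, 4, 3, 1, 1] ∧ FermatCharacter.Claim 6 2 ![3, 2, 2, 1, 5, 5] := by
  have h₁ : FermatCharacter.Claim 6 2 ![1, 2, 2, 3, 5, 5] :=
    FermatCharacter.claim_cone_surface_of_juxtaposition hJ (α := ![1, 5]) (β := ![2, 2, 3, 5])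
      (by unfold FermatCharacter.IsHodge FermatCharacter.IsAdmissible FermatCharacter.normSum; decide)
      (by unfold FermatCharacter.IsHodge FermatCharacter.IsAdmissible FermatCharacter.normSum; decide)
      (by decide)
  have h₂ : FermatCharacter.Claim 6 2 ![3, 4, 4, 5, 1, 1] :=
    FermatCharacter.claim_cone_surface_of_juxtaposition hJ (α := ![5, 1]) (β := ![3, 4, 4, 1])
      (by unfold FermatCharacter.IsHodge FermatCharacter.IsAdmissible FermatCharacter.normSum; decide)
      (by unfold FermatCharacter.IsHodge FermatCharacter.IsAdmissible FermatCharacter.normSum; decide)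
      (by decide)
  refine ⟨h₁, h₂, ?_, ?_⟩
  · have e : (![5, 4, 4, 3, 1, 1] : Fin (2 * 2 + 2) → ZMod 6) = -![1, 2, 2, 3, 5, 5] := by decide
    rw [e]; exact h₁.neg
  · have e : (![3, 2, 2, 1, 5, 5] : Fin (2 * 2 + 2) → ZMod 6) = -![3, 4, 4, 5, 1, 1] := by decide
    rw [e]; exact h₂.neg

end Literature.AlgebraicGeometry.HodgeTheory

end
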